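import Mathlib
import Summits.MatrixMultiplication.MatrixMultiplication.Theorems.ThinBlockAlphaThinPackingsOrbitCriterion

/-!
# Orbit designs for `ThinPackings`: product closure

Line `automorphism-orbit-twisted-templates` (skeleton `Ideator4Sketch`) of crux
`ThinBlockAlpha.ThinPackings` (stmt-MatrixMultiplication-10595), stub `stub_orbitProduct`.

Two orbit designs `(Γ₁, H₁, A₁, B₁, C₁)` and `(Γ₂, H₂, A₂, B₂, C₂)` — each a finite group acting on a
finite abelian group by additive automorphisms together with a template that is TPP (`TemplateTPP`)
and twisted sum-free (`TwistedSumFree`) — give an orbit design for `Γ₁ × Γ₂` acting COMPONENTWISE on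
`H₁ × H₂`, with legs the finset products `A₁ ×ˢ A₂`, `B₁ ×ˢ B₂`, `C₁ ×ˢ C₂`.

* `exists_prodAction`: the componentwise action `(g₁, g₂) • (x₁, x₂) = (g₁ • x₁, g₂ • x₂)` exists as a
  `DistribMulAction (Γ₁ × Γ₂) (H₁ × H₂)` (Mathlib's `Prod.distribMulAction` is the diagonal action of
  ONE monoid, so the instance is built by hand and only its defining equation is exported).
* `templateTPP_product`: a relation in `H₁ × H₂` is a pair of relations; apply the factor TPPs.
* `twistedSumFree_product`: labels `((g₁, g₂), (h₁, h₂)) ≠ (1, 1)` have `(g₁, h₁) ≠ (1, 1)` or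
  `(g₂, h₂) ≠ (1, 1)`; in that coordinate the factor is twisted sum-free.
* `stub_orbitProduct`: the registered stub, verbatim.
-/

set_option linter.dupNamespace false  -- `Summit.<S>.<S>.…` is the mandated namespace

namespace Summit.MatrixMultiplication.MatrixMultiplication.Theorems.ThinPackings.Orbit

open Finset

section Product

variable {Γ₁ H₁ Γ₂ H₂ : Type}

/-- The componentwise action of `Γ₁ × Γ₂` on `H₁ × H₂` exists: some `DistribMulAction` instance
satisfies `(g₁, g₂) • (x₁, x₂) = (g₁ • x₁, g₂ • x₂)`. -/
theorem exists_prodAction [Monoid Γ₁] [AddMonoid H₁] [DistribMulAction Γ₁ H₁]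
    [Monoid Γ₂] [AddMonoid H₂] [DistribMulAction Γ₂ H₂] :
    ∃ (_ : DistribMulAction (Γ₁ × Γ₂) (H₁ × H₂)),
      ∀ (g : Γ₁ × Γ₂) (x : H₁ × H₂), g • x = (g.1 • x.1, g.2 • x.2) := by
  let inst : DistribMulAction (Γ₁ × Γ₂) (H₁ × H₂) :=
    { smul := fun g x => (g.1 • x.1, g.2 • x.2)
      one_smul := fun x => Prod.ext (one_smul Γ₁ x.1) (one_smul Γ₂ x.2)
      mul_smul := fun g g' x => Prod.ext (mul_smul g.1 g'.1 x.1) (mul_smul g.2 g'.2 x.2)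
      smul_zero := fun g => Prod.ext (smul_zero g.1) (smul_zero g.2)
      smul_add := fun g x y => Prod.ext (smul_add g.1 x.1 y.1) (smul_add g.2 x.2 y.2) }
  exact ⟨inst, fun _ _ => rfl⟩

/-- **TPP of a product template.**  If `(A₁, B₁, C₁)` and `(A₂, B₂, C₂)` are TPP templates, so is
`(A₁ ×ˢ A₂, B₁ ×ˢ B₂, C₁ ×ˢ C₂)` in `H₁ × H₂`. [new, elementary] -/
theorem templateTPP_product [AddCommGroup H₁] [DecidableEq H₁] [AddCommGroup H₂] [DecidableEq H₂]
    {A₁ B₁ C₁ : Finset H₁} {A₂ B₂ C₂ : Finset H₂}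
    (h₁ : TemplateTPP A₁ B₁ C₁) (h₂ : TemplateTPP A₂ B₂ C₂) :
    TemplateTPP (A₁ ×ˢ A₂) (B₁ ×ˢ B₂) (C₁ ×ˢ C₂) := by
  rintro ⟨a₁, a₂⟩ ha ⟨a₁', a₂'⟩ ha' ⟨b₁, b₂⟩ hb ⟨b₁', b₂'⟩ hb' ⟨c₁, c₂⟩ hc ⟨c₁', c₂'⟩ hc' hrel
  simp only [mem_product] at ha ha' hb hb' hc hc'
  simp only [Prod.mk_sub_mk, Prod.mk_add_mk, Prod.mk_eq_zero] at hrel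
  obtain ⟨rfl, rfl, rfl⟩ := h₁ a₁ ha.1 a₁' ha'.1 b₁ hb.1 b₁' hb'.1 c₁ hc.1 c₁' hc'.1 hrel.1
  obtain ⟨rfl, rfl, rfl⟩ := h₂ a₂ ha.2 a₂' ha'.2 b₂ hb.2 b₂' hb'.2 c₂ hc.2 c₂' hc'.2 hrel.2
  exact ⟨rfl, rfl, rfl⟩

/-- **Twisted sum-freeness of a product template** under any componentwise action of `Γ₁ × Γ₂` on
`H₁ × H₂`: labels `(g, h) ≠ (1, 1)` in `(Γ₁ × Γ₂)²` are non-trivial in some coordinate, where the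
factor template is twisted sum-free. [new, elementary] -/
theorem twistedSumFree_product [Group Γ₁] [Fintype Γ₁] [AddCommGroup H₁] [DecidableEq H₁]
    [DistribMulAction Γ₁ H₁] [Group Γ₂] [Fintype Γ₂] [AddCommGroup H₂] [DecidableEq H₂]
    [DistribMulAction Γ₂ H₂] [DistribMulAction (Γ₁ × Γ₂) (H₁ × H₂)]
    (hsmul : ∀ (g : Γ₁ × Γ₂) (x : H₁ × H₂), g • x = (g.1 • x.1, g.2 • x.2))
    {A₁ B₁ C₁ : Finset H₁} {A₂ B₂ C₂ : Finset H₂}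
    (h₁ : TwistedSumFree Γ₁ A₁ B₁ C₁) (h₂ : TwistedSumFree Γ₂ A₂ B₂ C₂) :
    TwistedSumFree (Γ₁ × Γ₂) (A₁ ×ˢ A₂) (B₁ ×ˢ B₂) (C₁ ×ˢ C₂) := by
  rintro ⟨g₁, g₂⟩ ⟨k₁, k₂⟩ hne ⟨a₁', a₂'⟩ ha' ⟨b₁, b₂⟩ hb ⟨b₁', b₂'⟩ hb' ⟨c₁, c₂⟩ hc ⟨c₁', c₂'⟩ hc'
    ⟨a₁, a₂⟩ ha hrel
  simp only [mem_product] at ha ha' hb hb' hc hc'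
  simp only [hsmul, Prod.mk_sub_mk, Prod.mk_add_mk, Prod.mk_eq_zero] at hrel
  by_cases hc₁ : (g₁, k₁) = ((1 : Γ₁), (1 : Γ₁))
  · simp only [Prod.mk.injEq] at hc₁
    obtain ⟨rfl, rfl⟩ := hc₁
    have hc₂ : (g₂, k₂) ≠ ((1 : Γ₂), (1 : Γ₂)) := by
      rintro hc₂
      simp only [Prod.mk.injEq] at hc₂
      obtain ⟨rfl, rfl⟩ := hc₂
      exact hne rfl
    exact h₂ g₂ k₂ hc₂ a₂' ha'.2 b₂ hb.2 b₂' hb'.2 c₂ hc.2 c₂' hc'.2 a₂ ha.2 hrel.2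
  · exact h₁ g₁ k₁ hc₁ a₁' ha'.1 b₁ hb.1 b₁' hb'.1 c₁ hc.1 c₁' hc'.1 a₁ ha.1 hrel.1

/-- **Product closure of orbit designs.**  Two orbit designs give one for `Γ₁ × Γ₂` acting
componentwise on `H₁ × H₂` (the action instance is exhibited), with product legs. -/
theorem orbitProduct [Group Γ₁] [Fintype Γ₁] [AddCommGroup H₁] [DecidableEq H₁]
    [DistribMulAction Γ₁ H₁] [Group Γ₂] [Fintype Γ₂] [AddCommGroup H₂] [DecidableEq H₂]
    [DistribMulAction Γ₂ H₂] {A₁ B₁ C₁ : Finset H₁} {A₂ B₂ C₂ : Finset H₂}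
    (hT₁ : TemplateTPP A₁ B₁ C₁) (hS₁ : TwistedSumFree Γ₁ A₁ B₁ C₁)
    (hT₂ : TemplateTPP A₂ B₂ C₂) (hS₂ : TwistedSumFree Γ₂ A₂ B₂ C₂) :
    ∃ (_ : DistribMulAction (Γ₁ × Γ₂) (H₁ × H₂)),
      TemplateTPP (A₁ ×ˢ A₂) (B₁ ×ˢ B₂) (C₁ ×ˢ C₂) ∧
        TwistedSumFree (Γ₁ × Γ₂) (A₁ ×ˢ A₂) (B₁ ×ˢ B₂) (C₁ ×ˢ C₂) := by
  obtain ⟨inst, hsmul⟩ := exists_prodAction (Γ₁ := Γ₁) (H₁ := H₁) (Γ₂ := Γ₂) (H₂ := H₂)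
  exact ⟨inst, templateTPP_product hT₁ hT₂, twistedSumFree_product hsmul hS₁ hS₂⟩

end Product

/-- **Registered stub `stub_orbitProduct`** of the line's skeleton (crux stmt-MatrixMultiplication-10595),
verbatim: product closure of orbit designs (componentwise action, product legs). -/
theorem stub_orbitProduct : ∀ {Γ₁ H₁ Γ₂ H₂ : Type} [Group Γ₁] [Fintype Γ₁] [AddCommGroup H₁] [Fintype H₁] [DecidableEq H₁] [DistribMulAction Γ₁ H₁] [Group Γ₂] [Fintype Γ₂] [AddCommGroup H₂] [Fintype H₂] [DecidableEq H₂] [DistribMulAction Γ₂ H₂] (A₁ B₁ C₁ : Finset H₁) (A₂ B₂ C₂ : Finset H₂), TemplateTPP A₁ B₁ C₁ → TwistedSumFree Γ₁ A₁ B₁ C₁ → TemplateTPP A₂ B₂ C₂ → TwistedSumFree Γ₂ A₂ B₂ C₂ → ∃ (_ : DistribMulAction (Γ₁ × Γ₂) (H₁ × H₂)), TemplateTPP (A₁ ×ˢ A₂) (B₁ ×ˢ B₂) (C₁ ×ˢ C₂) ∧ TwistedSumFree (Γ₁ × Γ₂) (A₁ ×ˢ A₂) (B₁ ×ˢ B₂)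 (C₁ ×ˢ C₂) :=
  fun _ _ _ _ _ _ hT₁ hS₁ hT₂ hS₂ => orbitProduct hT₁ hS₁ hT₂ hS₂

end Summit.MatrixMultiplication.MatrixMultiplication.Theorems.ThinPackings.Orbit
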